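import Summits.Ventures.LatticeQCDFlow.Exactness.IMHAnyStartMSE
import Summits.Ventures.LatticeQCDFlow.Scoring.ChainMeanSquareErrorSharp
import HarnessLib

/-!
# Every start, second order — the start is an `O(r^b/N²)` effect on the error bar:
# `|MSE_{μ₀}(N; b) − MSE_π(N)| ≤ r^b·4w(x₀)(4w(x₀) − 1)·D²/N²` for every initial law of flow-MCMC

HONEST FRAMING: exact (Metropolis-corrected) sampling algorithms for lattice gauge theory;
figures of merit are autocorrelation/cost numbers at stated couplings and volumes; no
continuum-physics claim.

Venture `LatticeQCDFlow` (cell pub-lqcd), topic `Exactness`; FANOUT row 30 (lean-1, GEN-35).  NEW WORK of the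
cell, general state space.  `K = indepMH q w` (normalised weight `w` maximal at `x₀`, `W = w(x₀) = 1/A`, `r = 1 − A`);
`a ≤ f ≤ c`, `m = π f`, `D = max(m − a, c − m)`, `A_{N,b} = (1/N)Σ_{i<N} f(X_{b+i})`, `MSE_{μ₀}(N; b) = E_{μ₀}[(A_{N,b} −
m)²]`, `MSE_π(N)` the equilibrium error.  `Exactness/IMHAnyStartMSE` (this generation) gave the exact split
`MSE_{μ₀}(N; b) − MSE_π(N) = r^b·(MSE_ν(N) − MSE_π(N))` and the ZEROTH-ORDER size `|MSE_ν(N) − MSE_π(N)| ≤ D²` of the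
bracket.  The Scoring row's pair-sum law (`Scoring/ChainMeanSquareErrorSharp.abs_sum_sum_chain_pair_sub_autocov_le`:
from ANY start the `N²` pair correlations `E[g(X_i)g(X_j)]` differ from the stationary `γ_{|i−j|}` by `O(1)` in total,
Doeblin constant `A`, rate `1 − A/2`) makes the bracket SECOND ORDER:

* §1 **`imh_chain_mse_anyStart_sub_stationary_abs_le`** — for EVERY initial law `ν` and `N ≥ 1` (no discards):
  `|MSE_ν(N) − MSE_π(N)| ≤ 4W(4W − 1)·D²/N²`.
* §2 **`imh_chain_windowMSE_anyStart_secondOrder`** — hence for every initial law `μ₀`, every `b`, `N ≥ 1`: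
  `|MSE_{μ₀}(N; b) − MSE_π(N)| ≤ r^b·4W(4W − 1)·D²/N²` — THE EXACT RATE `r^b` OF THIS LINEAGE TIMES THE `1/N²` OF THE
  SCORING ROW: after `b` discarded updates the start moves the mean-square error of a window average by a relative
  `O(r^b·W²/N)` against the leading `(2W − 1)·Var_π f/N`; with **`imh_chain_windowMSE_anyStart_abs_le_min`** —
  `≤ r^b·D²·min(1, 4W(4W − 1)/N²)` (the zeroth-order envelope of `IMHAnyStartMSE` kept for short windows).
* §3 **`imh_chain_windowMSE_anyStart_le_secondOrder`** — the error bar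
  `MSE_{μ₀}(N; b) ≤ (2W − 1)·Var_π f/N + r^b·4W(4W − 1)·D²/N²` from every start, and
  (**`imh_chain_windowMSE_anyStart_ge_secondOrder`**) `≥ MSE_π(N) − r^b·4W(4W − 1)·D²/N²`.

Reading (gauge files `Scaling/AutoregressiveGauge…AnyStartMSESecondOrder`): an exact gauge sampler started anywhere,
`b` configurations discarded, `N` kept: its error differs from the equilibrium run's by at most
`(1 − A)^b·(4/A)(4/A − 1)·D²/N²`.
NOT CLAIMED: the sharp constant of the `1/N²` term (GEN-32/33 computed it for the cold start: `(2W² − W)δ² − Wσ²_f`);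
the sign of the difference; unbounded observables.  No `sorry`, no new definitions, nothing cited as a fact.
-/

noncomputable section

namespace Summit.Ventures.LatticeQCDFlow.Exactness

open MeasureTheory ProbabilityTheory Function Finset
open scoped ENNReal
open Summit.Ventures.LatticeQCDFlow.Scoring Literature.Probability.MarkovChains

variable {Ω : Type*} [MeasurableSpace Ω] {q : Measure Ω} [IsProbabilityMeasure q] {w : Ω → ℝ}

/-! ## §1 No discards: every start's error is within `4W(4W − 1)·D²/N²` of the equilibrium error -/

/-- **`|MSE_ν(N) − MSE_π(N)| ≤ 4W(4W − 1)·D²/N²`** for EVERY initial law `ν` and `N ≥ 1` (`W = w(x₀)`,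
`D = max(π f − a, c − π f)`): the Scoring row's any-start pair-sum law with the flow-MCMC Doeblin constant `A = 1/W`.
[ours, composing the tree] -/
theorem imh_chain_mse_anyStart_sub_stationary_abs_le [Fact (Measurable w)] (hw0 : ∀ y, 0 < w y) {x₀ : Ω}
    (hmax : ∀ y, w y ≤ w x₀) [IsProbabilityMeasure (q.withDensity fun y => ENNReal.ofReal (w y))]
    (ν : Measure Ω) [IsProbabilityMeasure ν] {f : Ω → ℝ} (hf : Measurable f) {a c : ℝ}
    (ha : ∀ x, a ≤ f x) (hc : ∀ x, f x ≤ c) {N : ℕ} (hN : N ≠ 0) :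
    |∫ x, ((∑ i ∈ range N, f (x i)) / N - ∫ z, f z ∂(q.withDensity fun y => ENNReal.ofReal (w y))) ^ 2
        ∂(Kernel.trajMeasure (X := fun _ : ℕ => Ω) ν
          (fun n : ℕ => (indepMH q w).comap (fun h : (i : ↥(Finset.Iic n)) → Ω => h ⟨n, Finset.mem_Iic.2 le_rfl⟩)
            (measurable_pi_apply _))) -
      ∫ x, ((∑ i ∈ range N, f (x i)) / N - ∫ z, f z ∂(q.withDensity fun y => ENNReal.ofReal (w y))) ^ 2
        ∂(Kernel.trajMeasure (X := fun _ : ℕ => Ω) (q.withDensity fun y => ENNReal.ofReal (w y))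
          (fun n : ℕ => (indepMH q w).comap (fun h : (i : ↥(Finset.Iic n)) → Ω => h ⟨n, Finset.mem_Iic.2 le_rfl⟩)
            (measurable_pi_apply _)))| ≤
      4 * w x₀ * (4 * w x₀ - 1) *
        (max (∫ z, f z ∂(q.withDensity fun y => ENNReal.ofReal (w y)) - a)
          (c - ∫ z, f z ∂(q.withDensity fun y => ENNReal.ofReal (w y)))) ^ 2 / (N : ℝ) ^ 2 := by
  set π : Measure Ω := q.withDensity fun y => ENNReal.ofReal (w y) with hπdef
  set m := ∫ z, f z ∂π with hm
  set D := max (m - a) (c - m) with hD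
  have hw : Measurable w := Fact.out
  have hWpos : 0 < w x₀ := hw0 x₀
  have hW : 1 ≤ w x₀ := one_le_of_mode (q := q) hmax
  have hπK : Kernel.Invariant (indepMH q w) π := indepMH_invariant (q := q) hw hw0
  have hmin : ∀ x {B : Set Ω}, MeasurableSet B → (ENNReal.ofReal (w x₀))⁻¹ * π B ≤ indepMH q w x B :=
    fun x B hB => indepMH_apply_ge hw hw0 hmax x hB
  have hε0 : 0 < (ENNReal.ofReal (w x₀))⁻¹ := ENNReal.inv_pos.2 ENNReal.ofReal_ne_top
  have htoReal : ((ENNReal.ofReal (w x₀))⁻¹).toReal = (w x₀)⁻¹ := by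
    rw [ENNReal.toReal_inv, ENNReal.toReal_ofReal hWpos.le]
  obtain ⟨-, -, -, -, hhalf, -⟩ := half_const_bounds hmin hε0
  -- the centred observable `g = f − m` has `|g| ≤ D` and `π g = 0`
  have hC : ∀ x, |f x| ≤ max |a| |c| := fun x => abs_le_max_abs_abs (ha x) (hc x)
  have hgm : Measurable fun y => f y - m := hf.sub measurable_const
  have hgD : ∀ x, |f x - m| ≤ D := fun x => by
    rw [abs_le]
    constructor
    · have := le_max_left (m - a) (c - m); linarith [ha x]
    · exact le_trans (by linarith [hc x]) (le_max_right _ _)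
  have hg0 : ∫ x, f x - m ∂π = 0 := by
    rw [integral_sub (integrable_of_bounded π hf hC) (integrable_const m), integral_const, probReal_univ, one_smul,
      hm, sub_self]
  have hpair := abs_sum_sum_chain_pair_sub_autocov_le (κ := indepMH q w) hπK hmin hε0 hgm hgD hg0 ν N
  rw [hhalf, htoReal] at hpair
  -- the two mean-square errors as pair sums
  have hNpos : (0 : ℝ) < N := by exact_mod_cast Nat.pos_of_ne_zero hN
  have hN2 : (0 : ℝ) < (N : ℝ) ^ 2 := by positivity
  rw [chain_sqError_timeAverage_eq hf hC m hN, chain_mse_stationary_eq (indepMH q w) hπK hf hC hN, ← sub_div,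
    abs_div, abs_of_pos hN2, div_le_div_iff_of_pos_right hN2]
  refine hpair.trans (le_of_eq ?_)
  have hA0 : (w x₀)⁻¹ ≠ 0 := inv_ne_zero hWpos.ne'
  field_simp
  ring

/-! ## §2 After `b` discarded updates: the exact rate times the second order -/

/-- **THE START IS AN `O(r^b/N²)` EFFECT**: for every initial law `μ₀`, every `b` and `N ≥ 1`,
`|MSE_{μ₀}(N; b) − MSE_π(N)| ≤ r^b·4W(4W − 1)·D²/N²`. [ours] -/
theorem imh_chain_windowMSE_anyStart_secondOrder [Fact (Measurable w)] (hw0 : ∀ y, 0 < w y) {x₀ : Ω}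
    (hmax : ∀ y, w y ≤ w x₀) [IsProbabilityMeasure (q.withDensity fun y => ENNReal.ofReal (w y))]
    (μ₀ : Measure Ω) [IsProbabilityMeasure μ₀] {f : Ω → ℝ} (hf : Measurable f) {a c : ℝ}
    (ha : ∀ x, a ≤ f x) (hc : ∀ x, f x ≤ c) (b : ℕ) {N : ℕ} (hN : N ≠ 0) :
    |∫ x, ((∑ i ∈ range N, f (x (b + i))) / N - ∫ z, f z ∂(q.withDensity fun y => ENNReal.ofReal (w y))) ^ 2
        ∂(Kernel.trajMeasure (X := fun _ : ℕ => Ω) μ₀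
          (fun n : ℕ => (indepMH q w).comap (fun h : (i : ↥(Finset.Iic n)) → Ω => h ⟨n, Finset.mem_Iic.2 le_rfl⟩)
            (measurable_pi_apply _))) -
      ∫ x, ((∑ i ∈ range N, f (x i)) / N - ∫ z, f z ∂(q.withDensity fun y => ENNReal.ofReal (w y))) ^ 2
        ∂(Kernel.trajMeasure (X := fun _ : ℕ => Ω) (q.withDensity fun y => ENNReal.ofReal (w y))
          (fun n : ℕ => (indepMH q w).comap (fun h : (i : ↥(Finset.Iic n)) → Ω => h ⟨n, Finset.mem_Iic.2 le_rfl⟩)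
            (measurable_pi_apply _)))| ≤
      (1 - (w x₀)⁻¹) ^ b * (4 * w x₀ * (4 * w x₀ - 1) *
        (max (∫ z, f z ∂(q.withDensity fun y => ENNReal.ofReal (w y)) - a)
          (c - ∫ z, f z ∂(q.withDensity fun y => ENNReal.ofReal (w y)))) ^ 2 / (N : ℝ) ^ 2) := by
  obtain ⟨ν, hν, hsplit⟩ := imh_chain_windowMSE_anyStart_exists (q := q) hw0 hmax μ₀ hf ha hc b hN (x₀ := x₀)
  have hν' := imh_chain_mse_anyStart_sub_stationary_abs_le (q := q) hw0 hmax ν hf ha hc hN (x₀ := x₀)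
  have hW : 1 ≤ w x₀ := one_le_of_mode (q := q) hmax
  have hr0 : 0 ≤ (1 - (w x₀)⁻¹) ^ b := pow_nonneg (sub_nonneg.2 (inv_le_one_of_one_le₀ hW)) b
  set Mπ := ∫ x, ((∑ i ∈ range N, f (x i)) / N - ∫ z, f z ∂(q.withDensity fun y => ENNReal.ofReal (w y))) ^ 2
    ∂(Kernel.trajMeasure (X := fun _ : ℕ => Ω) (q.withDensity fun y => ENNReal.ofReal (w y))
      (fun n : ℕ => (indepMH q w).comap (fun h : (i : ↥(Finset.Iic n)) → Ω => h ⟨n, Finset.mem_Iic.2 le_rfl⟩)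
        (measurable_pi_apply _))) with hMπ
  set Mν := ∫ x, ((∑ i ∈ range N, f (x i)) / N - ∫ z, f z ∂(q.withDensity fun y => ENNReal.ofReal (w y))) ^ 2
    ∂(Kernel.trajMeasure (X := fun _ : ℕ => Ω) ν
      (fun n : ℕ => (indepMH q w).comap (fun h : (i : ↥(Finset.Iic n)) → Ω => h ⟨n, Finset.mem_Iic.2 le_rfl⟩)
        (measurable_pi_apply _))) with hMν
  rw [hsplit, show (1 - (1 - (w x₀)⁻¹) ^ b) * Mπ + (1 - (w x₀)⁻¹) ^ b * Mν - Mπ =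
    (1 - (w x₀)⁻¹) ^ b * (Mν - Mπ) by ring, abs_mul, abs_of_nonneg hr0]
  exact mul_le_mul_of_nonneg_left hν' hr0

/-- **Both orders at once**: `|MSE_{μ₀}(N; b) − MSE_π(N)| ≤ r^b·D²·min(1, 4W(4W − 1)/N²)`. [ours] -/
theorem imh_chain_windowMSE_anyStart_abs_le_min [Fact (Measurable w)] (hw0 : ∀ y, 0 < w y) {x₀ : Ω}
    (hmax : ∀ y, w y ≤ w x₀) [IsProbabilityMeasure (q.withDensity fun y => ENNReal.ofReal (w y))]
    (μ₀ : Measure Ω) [IsProbabilityMeasure μ₀] {f : Ω → ℝ} (hf : Measurable f) {a c : ℝ}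
    (ha : ∀ x, a ≤ f x) (hc : ∀ x, f x ≤ c) (b : ℕ) {N : ℕ} (hN : N ≠ 0) :
    |∫ x, ((∑ i ∈ range N, f (x (b + i))) / N - ∫ z, f z ∂(q.withDensity fun y => ENNReal.ofReal (w y))) ^ 2
        ∂(Kernel.trajMeasure (X := fun _ : ℕ => Ω) μ₀
          (fun n : ℕ => (indepMH q w).comap (fun h : (i : ↥(Finset.Iic n)) → Ω => h ⟨n, Finset.mem_Iic.2 le_rfl⟩)
            (measurable_pi_apply _))) -
      ∫ x, ((∑ i ∈ range N, f (x i)) / N - ∫ z, f z ∂(q.withDensity fun y => ENNReal.ofReal (w y))) ^ 2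
        ∂(Kernel.trajMeasure (X := fun _ : ℕ => Ω) (q.withDensity fun y => ENNReal.ofReal (w y))
          (fun n : ℕ => (indepMH q w).comap (fun h : (i : ↥(Finset.Iic n)) → Ω => h ⟨n, Finset.mem_Iic.2 le_rfl⟩)
            (measurable_pi_apply _)))| ≤
      (1 - (w x₀)⁻¹) ^ b *
        (max (∫ z, f z ∂(q.withDensity fun y => ENNReal.ofReal (w y)) - a)
          (c - ∫ z, f z ∂(q.withDensity fun y => ENNReal.ofReal (w y)))) ^ 2 *
        min 1 (4 * w x₀ * (4 * w x₀ - 1) / (N : ℝ) ^ 2) := by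
  have h1 := imh_chain_windowMSE_anyStart_abs_le (q := q) hw0 hmax μ₀ hf ha hc b hN (x₀ := x₀)
  have h2 := imh_chain_windowMSE_anyStart_secondOrder (q := q) hw0 hmax μ₀ hf ha hc b hN (x₀ := x₀)
  have hW : 1 ≤ w x₀ := one_le_of_mode (q := q) hmax
  have hr0 : 0 ≤ (1 - (w x₀)⁻¹) ^ b := pow_nonneg (sub_nonneg.2 (inv_le_one_of_one_le₀ hW)) b
  set D2 := (max (∫ z, f z ∂(q.withDensity fun y => ENNReal.ofReal (w y)) - a)
    (c - ∫ z, f z ∂(q.withDensity fun y => ENNReal.ofReal (w y)))) ^ 2 with hD2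
  have hD0 : 0 ≤ D2 := sq_nonneg _
  rcases le_total 1 (4 * w x₀ * (4 * w x₀ - 1) / (N : ℝ) ^ 2) with h | h
  · rw [min_eq_left h, mul_one]; exact h1
  · rw [min_eq_right h]
    calc _ ≤ _ := h2
      _ = _ := by ring

/-! ## §3 The error bar from every start, to second order -/

/-- **`MSE_{μ₀}(N; b) ≤ (2W − 1)·Var_π f/N + r^b·4W(4W − 1)·D²/N²`** from every start (`N ≥ 1`). [ours] -/
theorem imh_chain_windowMSE_anyStart_le_secondOrder [Fact (Measurable w)] (hw0 : ∀ y, 0 < w y) {x₀ : Ω}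
    (hmax : ∀ y, w y ≤ w x₀) [IsProbabilityMeasure (q.withDensity fun y => ENNReal.ofReal (w y))]
    (μ₀ : Measure Ω) [IsProbabilityMeasure μ₀] {f : Ω → ℝ} (hf : Measurable f) {a c : ℝ}
    (ha : ∀ x, a ≤ f x) (hc : ∀ x, f x ≤ c) (b : ℕ) {N : ℕ} (hN : N ≠ 0) :
    ∫ x, ((∑ i ∈ range N, f (x (b + i))) / N - ∫ z, f z ∂(q.withDensity fun y => ENNReal.ofReal (w y))) ^ 2
        ∂(Kernel.trajMeasure (X := fun _ : ℕ => Ω) μ₀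
          (fun n : ℕ => (indepMH q w).comap (fun h : (i : ↥(Finset.Iic n)) → Ω => h ⟨n, Finset.mem_Iic.2 le_rfl⟩)
            (measurable_pi_apply _))) ≤
      (2 * w x₀ - 1) *
          (∫ x, (f x - ∫ z, f z ∂(q.withDensity fun y => ENNReal.ofReal (w y))) ^ 2
            ∂(q.withDensity fun y => ENNReal.ofReal (w y))) / N +
        (1 - (w x₀)⁻¹) ^ b * (4 * w x₀ * (4 * w x₀ - 1) *
          (max (∫ z, f z ∂(q.withDensity fun y => ENNReal.ofReal (w y)) - a)
            (c - ∫ z, f z ∂(q.withDensity fun y => ENNReal.ofReal (w y)))) ^ 2 / (N : ℝ) ^ 2) := by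
  have h1 := imh_chain_windowMSE_anyStart_secondOrder (q := q) hw0 hmax μ₀ hf ha hc b hN (x₀ := x₀)
  have hC : ∀ x, |f x| ≤ max |a| |c| := fun x => abs_le_max_abs_abs (ha x) (hc x)
  have h2 := imh_chain_mse_stationary_le (q := q) hw0 hmax hf hC hN (x₀ := x₀)
  rw [abs_le] at h1
  linarith [h1.2]

/-- **… and `MSE_{μ₀}(N; b) ≥ MSE_π(N) − r^b·4W(4W − 1)·D²/N²`** from every start. [ours] -/
theorem imh_chain_windowMSE_anyStart_ge_secondOrder [Fact (Measurable w)] (hw0 : ∀ y, 0 < w y) {x₀ : Ω}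
    (hmax : ∀ y, w y ≤ w x₀) [IsProbabilityMeasure (q.withDensity fun y => ENNReal.ofReal (w y))]
    (μ₀ : Measure Ω) [IsProbabilityMeasure μ₀] {f : Ω → ℝ} (hf : Measurable f) {a c : ℝ}
    (ha : ∀ x, a ≤ f x) (hc : ∀ x, f x ≤ c) (b : ℕ) {N : ℕ} (hN : N ≠ 0) :
    ∫ x, ((∑ i ∈ range N, f (x i)) / N - ∫ z, f z ∂(q.withDensity fun y => ENNReal.ofReal (w y))) ^ 2
        ∂(Kernel.trajMeasure (X := fun _ : ℕ => Ω) (q.withDensity fun y => ENNReal.ofReal (w y))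
          (fun n : ℕ => (indepMH q w).comap (fun h : (i : ↥(Finset.Iic n)) → Ω => h ⟨n, Finset.mem_Iic.2 le_rfl⟩)
            (measurable_pi_apply _))) -
        (1 - (w x₀)⁻¹) ^ b * (4 * w x₀ * (4 * w x₀ - 1) *
          (max (∫ z, f z ∂(q.withDensity fun y => ENNReal.ofReal (w y)) - a)
            (c - ∫ z, f z ∂(q.withDensity fun y => ENNReal.ofReal (w y)))) ^ 2 / (N : ℝ) ^ 2) ≤
      ∫ x, ((∑ i ∈ range N, f (x (b + i))) / N - ∫ z, f z ∂(q.withDensity fun y => ENNReal.ofReal (w y))) ^ 2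
        ∂(Kernel.trajMeasure (X := fun _ : ℕ => Ω) μ₀
          (fun n : ℕ => (indepMH q w).comap (fun h : (i : ↥(Finset.Iic n)) → Ω => h ⟨n, Finset.mem_Iic.2 le_rfl⟩)
            (measurable_pi_apply _))) := by
  have h1 := imh_chain_windowMSE_anyStart_secondOrder (q := q) hw0 hmax μ₀ hf ha hc b hN (x₀ := x₀)
  rw [abs_le] at h1
  linarith [h1.1]

end Summit.Ventures.LatticeQCDFlow.Exactness
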